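import Summits.Schanuel.Schanuel.Theorems.RootDecomp1KCor52Holds04

/-!
# RootDecomp1KCor52Holds — lens 6, generation 21 «GENERAL COR. 5.2, HYPOTHESIS-FREE» (RULE K-R29 (i), FRAME G21, LANE T): the registered Literature named fact `Literature.Barriers.Schanuel.NesterenkoPhilippon2001_ch3_cor_5_2` (LNM 1752 Ch. 3 Cor. 5.2 in PRINT GENERALITY: every q with 0 < |q| < 1, every ξ ∈ ℂ³ over which q, P(q), Q(q), R(q) are algebraic) DISCHARGED BY NAME — `theorem NesterenkoPhilippon2001_ch3_cor_5_2_holds : NesterenkoPhilippon2001_ch3_cor_5_2` from tree theorems only (Thm 1.1, Thm 5.1 at r = 3, Props 4.8 / 4.11, the norm step of p. 47) — continuation (RootDecomp1KCor52Holds05): §4e norm step, analytic half `norm_step` + §5 `NesterenkoPhilippon2001_ch3_cor_5_2_holds` and the binder-free π-clause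

(lens-6 g21 HOME kernel Cor52.lean 7faa26d9…, 1013 l, ONE import = tree RootDecomp1KPiScale01, namespace `Summit.Schanuel.Schanuel.Theorems.RootDecomp1KCor52`; CLAIM L2014, FRAME G21 L2016, NODE L2073 / RESULT L2074, critic VERDICT L2077 (crit g8: CLEARED — THEOREM ×1, the registered Literature fact discharged BY NAME in print generality; lens-6 tally THEOREM ×4 + CELL ×3; PORT NOW Summit-side, `--supports stmt-Schanuel-33363` = the PiCells/Hyper consumers it un-conditions; Literature relocation = later ops hoist of the four Summit helpers); Summit-side home because the kernel uses Summit helpers (`mvlen` algebra Hyper03/42, det bounds Hyper47, `natAbs_coeff_sup_le_mvlen` PiCells, `norm_mvaeval_le_mvlen_mul_pow` RelLiouvilleCell01) — NODE-g21.md §5; port by census-1 gen 18 as `RootDecomp1KCor52Holds01`–`05`: 01 = §1 transcendence-degree bookkeeping (`Kq`, `Lq`, `bookkeeping`) + §2 a dependent Ramanujan point lies on a prime form (`exists_prime_form_of_dependent`, `span_prime_form`); 02 = §3 the measure (31) at EVERY dependent Ramanujan point (`measure31_of_dependent`); 03 = §4 norm-step algebra (`exists_int_frac`, `exists_common_den`,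 `EB` entry bounds, `wt`, `matA`, `EB_matA`, `det_matA_bounds`) + §4d the evaluation identity (`ringHom_aeval_eq_sum`, `mapMatrix_matA`); 04 = §4e `norm_step_algebra` (B := det 𝔄_A, B(ω) = δ^{nD}·N_{L/K}(A(ξ))); 05 = §4e `norm_step` (analysis) + §5 `NesterenkoPhilippon2001_ch3_cor_5_2_holds` and the binder-free `{π, e^π, Γ(1/4)}` clause `NesterenkoPhilippon2001_ch3_cor_5_2_pi`.
PORT EDITS: `set_option linter.dupNamespace false` dropped; twelve one-line docstrings added; six generic helpers made `private` (`trdeg_adjoin_le_of_isAlgebraic`, `isAlgebraic_of_mem_adjoin`, `four_le_trdeg_of_algebraicIndependent`, `one_le_log_of_exp_le`, `ringHom_mvaeval`, `mapMatrix_smul` — tree twins exist) with per-part private copies; the three scoped `synthInstance.maxHeartbeats 400000 in` and `attribute [local instance] MvPolynomial.gradedAlgebra` kept in 01–02 (precedent PiScale01); statements and proofs verbatim EXCEPT the reviewer's revision of part 03 (review of p827651): `def wt` / `wt_le_totalDegree` deleted in favour of Mathlib's `Finsupp.degree` (`α.degree` in `matA`, `EB_matA`, `mapMatrix_matA`, `norm_step`;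 `rw [Finsupp.degree_eq_sum, Fin.sum_univ_three]` where the three-term form is needed) and the unused `attribute [local instance] MvPolynomial.gradedAlgebra` dropped from parts 03–05, and `structure EB … : Prop` turned into the proof-neutral `def EB … : Prop := 0 ≤ l ∧ ∀ a b, …` (the lens's 14:29Z draft form; critic L2077/L2082). `--supports stmt-Schanuel-33363`; no census credit carried; rung 0 — nothing here proves Schanuel.)
-/

noncomputable section

open Complex IntermediateField
open MvPolynomial (aeval rename X C)
open Literature.NumberTheory.Transcendental
open Literature.NumberTheory.Transcendental.Nesterenko
open Literature.Barriers.Schanuel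
open Summit.Schanuel.Schanuel.Theorems.RootDecomp1KHyper

namespace Summit.Schanuel.Schanuel.Theorems.RootDecomp1KCor52

/-- `1 ≤ log T` for `e ≤ T`. -/
private theorem one_le_log_of_exp_le {x : ℝ} (hx : Real.exp 1 ≤ x) : 1 ≤ Real.log x := by
  rw [← Real.log_exp 1]; exact Real.log_le_log (Real.exp_pos 1) hx

/-- **Norm step** (both halves): `ω : Fin 4 → ℂ`, `K = ℚ(ω)`, `ξ : Fin 3 → ℂ` algebraically independent with
`L = K(ξ)` algebraic over `K`, and a measure `exp(−c T⁴ log²⁴ T) ≤ |B(ω)|` (`T ≥ max (deg B + log H(B)) e`) for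
every `B ∈ ℤ[y₁,…,y₄]` with `B(ω) ≠ 0`. Then `∃ μ > 0, ∀ A ∈ ℤ[x₁,x₂,x₃] ∖ 0, ∀ T ≥ max (H(A) + deg A) e,
exp(−μ T⁴ log²⁴ T) ≤ |A(ξ)|`. [cite: NesterenkoPhilippon2001, Ch. 3, proof of Cor. 5.2 (p. 47)] -/
theorem norm_step (ω : Fin 4 → ℂ) (ξ : Fin 3 → ℂ) (hξ : AlgebraicIndependent ℚ ξ)
    (halg : Algebra.IsAlgebraic (adjoin ℚ (Set.range ω)) (adjoin (adjoin ℚ (Set.range ω)) (Set.range ξ)))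
    {c : ℝ} (hc : 0 < c)
    (hmeas : ∀ B : MvPolynomial (Fin 4) ℤ, aeval ω B ≠ 0 → ∀ T : ℝ,
      max ((B.totalDegree : ℝ) + Real.log (mvPolyHeight B)) (Real.exp 1) ≤ T →
        Real.exp (-(c * T ^ 4 * Real.log T ^ 24)) ≤ ‖aeval ω B‖) :
    ∃ μ : ℝ, 0 < μ ∧ ∀ A : MvPolynomial (Fin 3) ℤ, A ≠ 0 → ∀ T : ℝ,
      max ((mvPolyHeight A : ℝ) + (A.totalDegree : ℝ)) (Real.exp 1) ≤ T →
        Real.exp (-(μ * T ^ 4 * Real.log T ^ 24)) ≤ ‖aeval ξ A‖ := by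
  classical
  obtain ⟨D, Ec, g, l, δ, Rb, hD1, hl1, hδ0, hRb1, hAB⟩ := norm_step_algebra ω ξ hξ halg
  -- constants
  set δ₁ : ℝ := max ‖δ‖ 1 with hδ₁
  have hδ₁1 : 1 ≤ δ₁ := le_max_right _ _
  have hδle : ‖δ‖ ≤ δ₁ := le_max_left _ _
  clear_value δ₁
  have hlogδ₁ : 0 ≤ Real.log δ₁ := Real.log_nonneg hδ₁1
  have hlogRb : 0 ≤ Real.log Rb := Real.log_nonneg hRb1
  have hDr : (1 : ℝ) ≤ D := by exact_mod_cast hD1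
  have hD0 : (0 : ℝ) ≤ D := by linarith only [hDr]
  have hlr : (1 : ℝ) ≤ l := by exact_mod_cast hl1
  have hDl1 : (1 : ℝ) ≤ (D : ℝ) * l := one_le_mul_of_one_le_of_one_le hDr hlr
  have hlogD : 0 ≤ Real.log D := Real.log_nonneg hDr
  have hlogDl : 0 ≤ Real.log ((D : ℝ) * l) := Real.log_nonneg hDl1
  have hfact1 : (1 : ℝ) ≤ Nat.factorial D := by exact_mod_cast Nat.factorial_pos D
  have hlogfact : 0 ≤ Real.log (Nat.factorial D) := Real.log_nonneg hfact1
  set cB : ℝ := Real.log (Nat.factorial D) + D * (4 + 2 * Real.log D + Real.log ((D : ℝ) * l)) with hcB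
  clear_value cB
  have hcB0 : 0 ≤ cB := by rw [hcB]; positivity
  have hg0 : (0 : ℝ) ≤ (D : ℝ) * g := by positivity
  set cT : ℝ := D * g + cB + 1 with hcT
  clear_value cT
  have hcT1 : 1 ≤ cT := by rw [hcT]; linarith only [hg0, hcB0]
  have hcT0 : 0 < cT := by linarith only [hcT1]
  have hlogcT : 0 ≤ Real.log cT := Real.log_nonneg hcT1
  set κ : ℝ := (1 + Real.log cT) ^ 24 with hκ
  clear_value κ
  have hκ1 : 1 ≤ κ := by rw [hκ]; exact one_le_pow₀ (by linarith only [hlogcT])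
  have hκ0 : 0 < κ := lt_of_lt_of_le one_pos hκ1
  set ν : ℝ := (D : ℝ) * Real.log δ₁ + Ec * (4 + Real.log Rb) with hν
  clear_value ν
  have hν0 : 0 ≤ ν := by rw [hν]; positivity
  have hμ0 : 0 < c * cT ^ 4 * κ + ν := by
    have := mul_pos (mul_pos hc (pow_pos hcT0 4)) hκ0
    linarith only [this, hν0]
  refine ⟨c * cT ^ 4 * κ + ν, hμ0, ?_⟩
  intro A hA T hT
  obtain ⟨B, hB0, hBdeg, hBlen, hBle⟩ := hAB A hA
  set n := A.totalDegree with hndef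
  -- `T`
  have hTe : Real.exp 1 ≤ T := le_trans (le_max_right _ _) hT
  have hT1 : 1 ≤ T := le_trans (by have := Real.add_one_le_exp (1 : ℝ); linarith only [this]) hTe
  have hT0 : 0 < T := by linarith only [hT1]
  have hlogT : 1 ≤ Real.log T := one_le_log_of_exp_le hTe
  have hHn : (mvPolyHeight A : ℝ) + n ≤ T := le_trans (le_max_left _ _) hT
  have hH1 : (1 : ℝ) ≤ mvPolyHeight A := by exact_mod_cast PhilipponMain.one_le_mvPolyHeight hA
  have hn0 : (0 : ℝ) ≤ n := Nat.cast_nonneg _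
  have hnT : (n : ℝ) ≤ T := by linarith only [hHn, hH1]
  have hBne : B ≠ 0 := fun h => hB0 (by rw [h, map_zero])
  -- reals
  set ℓA : ℝ := ((mvlen A : ℤ) : ℝ) with hℓA
  clear_value ℓA
  have hℓA1 : 1 ≤ ℓA := by rw [hℓA]; exact_mod_cast one_le_mvlen hA
  have hℓA0 : 0 < ℓA := by linarith only [hℓA1]
  set LB : ℝ := ((mvlen B : ℤ) : ℝ) with hLB
  clear_value LB
  have hLB1 : 1 ≤ LB := by rw [hLB]; exact_mod_cast one_le_mvlen hBne
  have hLB0 : 0 < LB := by linarith only [hLB1]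
  -- `log len(A) ≤ 3 T`: `len(A) ≤ (n+1)³ H(A)`
  have hcard : (A.support.card : ℝ) ≤ ((n : ℝ) + 1) ^ 3 := by
    have h : A.support.card ≤ (n + 1) ^ 3 := by
      have h := Finset.card_le_card_of_injOn (s := A.support)
        (t := Fintype.piFinset fun _ : Fin 3 => Finset.range (n + 1))
        (fun e : (Fin 3 →₀ ℕ) => (⇑e : Fin 3 → ℕ)) (fun e he => by
          rw [Finset.mem_coe, Fintype.mem_piFinset]
          intro i
          have hwt : e.degree ≤ A.totalDegree := MvPolynomial.le_totalDegree he
          have h3 : e i ≤ e.degree := by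
            rw [Finsupp.degree_eq_sum]
            exact Finset.single_le_sum (f := fun j => e j) (fun j _ => Nat.zero_le _) (Finset.mem_univ i)
          exact Finset.mem_range.2 (show e i < n + 1 by omega))
        (fun e₁ _ e₂ _ h => DFunLike.coe_injective h)
      rwa [Fintype.card_piFinset_const, Finset.card_range] at h
    exact_mod_cast h
  have hℓAle : ℓA ≤ ((n : ℝ) + 1) ^ 3 * mvPolyHeight A := by
    have h : mvlen A ≤ (A.support.card : ℤ) * (mvPolyHeight A : ℤ) := by
      unfold mvlen
      calc ∑ m ∈ A.support, |A.coeff m| ≤ ∑ _m ∈ A.support, (mvPolyHeight A : ℤ) := by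
            refine Finset.sum_le_sum fun m hm => ?_
            rw [← Int.natCast_natAbs]
            exact_mod_cast Finset.le_sup (f := fun m => (A.coeff m).natAbs) hm
        _ = (A.support.card : ℤ) * (mvPolyHeight A : ℤ) := by rw [Finset.sum_const, nsmul_eq_mul]
    have h' : ℓA ≤ (A.support.card : ℝ) * mvPolyHeight A := by rw [hℓA]; exact_mod_cast h
    exact h'.trans (mul_le_mul_of_nonneg_right hcard (by linarith only [hH1]))
  have hlogℓA : Real.log ℓA ≤ 3 * T := by
    have h1 : Real.log ℓA ≤ Real.log (((n : ℝ) + 1) ^ 3 * mvPolyHeight A) := Real.log_le_log hℓA0 hℓAle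
    have h2 : Real.log (((n : ℝ) + 1) ^ 3 * mvPolyHeight A) = 3 * Real.log ((n : ℝ) + 1) +
        Real.log (mvPolyHeight A) := by
      rw [Real.log_mul (by positivity) (by linarith only [hH1] : (0 : ℝ) < mvPolyHeight A).ne', Real.log_pow]
      push_cast; ring
    have h3 : Real.log ((n : ℝ) + 1) ≤ n := by
      have := Real.log_le_sub_one_of_pos (show (0 : ℝ) < n + 1 by linarith only [hn0])
      linarith only [this]
    have h4 : Real.log (mvPolyHeight A) ≤ mvPolyHeight A - 1 :=
      Real.log_le_sub_one_of_pos (by linarith only [hH1])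
    linarith only [h1, h2, h3, h4, hHn, hH1, hn0]
  have hlogℓA0 : 0 ≤ Real.log ℓA := Real.log_nonneg hℓA1
  -- `log len(B) ≤ cB T`
  have hLBle : LB ≤ (Nat.factorial D : ℝ) * (ℓA * ((D : ℝ) ^ 2 * ((D : ℝ) * l) ^ n)) ^ D := by
    rw [hLB, hℓA]; exact_mod_cast hBlen
  have hlogLB : Real.log LB ≤ cB * T := by
    have h1 : Real.log LB ≤ Real.log ((Nat.factorial D : ℝ) * (ℓA * ((D : ℝ) ^ 2 * ((D : ℝ) * l) ^ n)) ^ D) :=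
      Real.log_le_log hLB0 hLBle
    have h2 : Real.log ((Nat.factorial D : ℝ) * (ℓA * ((D : ℝ) ^ 2 * ((D : ℝ) * l) ^ n)) ^ D) =
        Real.log (Nat.factorial D) + D * (Real.log ℓA + 2 * Real.log D + n * Real.log ((D : ℝ) * l)) := by
      rw [Real.log_mul (by positivity) (by positivity), Real.log_pow, Real.log_mul (by positivity) (by positivity),
        Real.log_mul (by positivity) (by positivity), Real.log_pow, Real.log_pow]
      push_cast; ring
    rw [h2] at h1
    have ha : (n : ℝ) * Real.log ((D : ℝ) * l) ≤ T * Real.log ((D : ℝ) * l) :=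
      mul_le_mul_of_nonneg_right hnT hlogDl
    have hb : 2 * Real.log D ≤ 2 * Real.log D * T := le_mul_of_one_le_right (by positivity) hT1
    have h31 : Real.log ℓA + 2 * Real.log D + n * Real.log ((D : ℝ) * l) ≤
        (4 + 2 * Real.log D + Real.log ((D : ℝ) * l)) * T := by linarith only [hlogℓA, ha, hb, hT0]
    have h3 := mul_le_mul_of_nonneg_left h31 hD0
    have h4 : Real.log (Nat.factorial D) ≤ Real.log (Nat.factorial D) * T := le_mul_of_one_le_right hlogfact hT1
    have h5 : (D : ℝ) * ((4 + 2 * Real.log D + Real.log ((D : ℝ) * l)) * T) =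
        (D : ℝ) * (4 + 2 * Real.log D + Real.log ((D : ℝ) * l)) * T := by ring
    rw [hcB]; linarith only [h1, h3, h4, h5]
  -- `H(B) ≤ len(B)`, `deg B ≤ D g n`: the measure applies at `B` with `T' = cT·T`
  have hHB : (mvPolyHeight B : ℝ) ≤ LB := by
    have := HyperCell.natAbs_coeff_sup_le_mvlen B
    rw [hLB]; unfold mvPolyHeight; exact_mod_cast this
  have hHB1 : (1 : ℝ) ≤ mvPolyHeight B := by exact_mod_cast PhilipponMain.one_le_mvPolyHeight hBne
  have hlogHB : Real.log (mvPolyHeight B) ≤ cB * T :=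
    le_trans (Real.log_le_log (by linarith only [hHB1]) hHB) hlogLB
  have hdegB : (B.totalDegree : ℝ) ≤ (D : ℝ) * g * T := by
    have h1 : (B.totalDegree : ℝ) ≤ (D : ℝ) * (n * g) := by exact_mod_cast hBdeg
    have h2 : (D : ℝ) * g * n ≤ (D : ℝ) * g * T := mul_le_mul_of_nonneg_left hnT hg0
    have h3 : (D : ℝ) * (n * g) = (D : ℝ) * g * n := by ring
    linarith only [h1, h2, h3]
  have hgT0 : 0 ≤ (D : ℝ) * g * T := by positivity
  have hcBT0 : 0 ≤ cB * T := by positivity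
  have hmaxB : max ((B.totalDegree : ℝ) + Real.log (mvPolyHeight B)) (Real.exp 1) ≤ cT * T := by
    have hcTT : cT * T = (D : ℝ) * g * T + cB * T + T := by rw [hcT]; ring
    rw [hcTT]
    exact max_le (by linarith only [hdegB, hlogHB, hT0]) (by linarith only [hTe, hgT0, hcBT0])
  have h0 := hmeas B hB0 (cT * T) hmaxB
  -- chain
  set MA : ℝ := ℓA * Rb ^ n with hMA
  clear_value MA
  have hMA1 : 1 ≤ MA := by rw [hMA]; exact one_le_mul_of_one_le_of_one_le hℓA1 (one_le_pow₀ hRb1)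
  have hMA0 : 0 < MA := by linarith only [hMA1]
  have hchain : Real.exp (-(c * (cT * T) ^ 4 * Real.log (cT * T) ^ 24)) ≤
      ‖δ‖ ^ (n * D) * (‖aeval ξ A‖ * MA ^ Ec) := le_trans h0 hBle
  -- exponent bookkeeping
  have hlogcTT : Real.log (cT * T) ≤ (1 + Real.log cT) * Real.log T := by
    rw [Real.log_mul hcT0.ne' hT0.ne']
    have h := mul_le_mul_of_nonneg_left hlogT hlogcT
    linarith only [h]
  have hlogcTT0 : 0 ≤ Real.log (cT * T) := Real.log_nonneg (one_le_mul_of_one_le_of_one_le hcT1 hT1)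
  have hpow24 : Real.log (cT * T) ^ 24 ≤ κ * Real.log T ^ 24 := by
    rw [hκ, ← mul_pow]; exact pow_le_pow_left₀ hlogcTT0 hlogcTT 24
  have hmain : c * (cT * T) ^ 4 * Real.log (cT * T) ^ 24 ≤ c * cT ^ 4 * κ * T ^ 4 * Real.log T ^ 24 := by
    rw [mul_pow]
    have h1 : c * (cT ^ 4 * T ^ 4) * Real.log (cT * T) ^ 24 ≤ c * (cT ^ 4 * T ^ 4) * (κ * Real.log T ^ 24) :=
      mul_le_mul_of_nonneg_left hpow24 (by positivity)
    calc c * (cT ^ 4 * T ^ 4) * Real.log (cT * T) ^ 24 ≤ c * (cT ^ 4 * T ^ 4) * (κ * Real.log T ^ 24) := h1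
      _ = c * cT ^ 4 * κ * T ^ 4 * Real.log T ^ 24 := by ring
  -- `|δ|^{nD} ≤ exp (D log δ₁ · T)` and `MA^{Ec} ≤ exp (Ec (4 + log Rb) T)`
  have hδpow : ‖δ‖ ^ (n * D) ≤ Real.exp ((D : ℝ) * Real.log δ₁ * T) := by
    have h1 : ‖δ‖ ^ (n * D) ≤ δ₁ ^ (n * D) := pow_le_pow_left₀ (norm_nonneg _) hδle _
    have h2 : δ₁ ^ (n * D) = Real.exp (((n * D : ℕ) : ℝ) * Real.log δ₁) := by
      rw [← Real.log_pow, Real.exp_log (pow_pos (by linarith only [hδ₁1]) _)]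
    rw [h2] at h1
    refine h1.trans (Real.exp_le_exp.mpr ?_)
    have h3 := mul_le_mul_of_nonneg_left hnT (mul_nonneg hD0 hlogδ₁)
    push_cast
    linarith only [h3]
  have hMApow : MA ^ Ec ≤ Real.exp ((Ec : ℝ) * (4 + Real.log Rb) * T) := by
    have h2 : MA ^ Ec = Real.exp ((Ec : ℝ) * Real.log MA) := by
      rw [← Real.log_pow, Real.exp_log (pow_pos hMA0 _)]
    rw [h2, Real.exp_le_exp]
    have h3 : Real.log MA = Real.log ℓA + n * Real.log Rb := by
      rw [hMA, Real.log_mul hℓA0.ne' (pow_pos (by linarith only [hRb1]) _).ne', Real.log_pow]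
    rw [h3]
    have ha : (n : ℝ) * Real.log Rb ≤ T * Real.log Rb := mul_le_mul_of_nonneg_right hnT hlogRb
    have h4 : Real.log ℓA + n * Real.log Rb ≤ (4 + Real.log Rb) * T := by linarith only [hlogℓA, ha, hT0]
    have h5 := mul_le_mul_of_nonneg_left h4 (Nat.cast_nonneg Ec)
    have h6 : (Ec : ℝ) * ((4 + Real.log Rb) * T) = (Ec : ℝ) * (4 + Real.log Rb) * T := by ring
    linarith only [h5, h6]
  -- conclude
  have hden : 0 < ‖δ‖ ^ (n * D) * MA ^ Ec := mul_pos (pow_pos (norm_pos_iff.mpr hδ0) _) (pow_pos hMA0 _)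
  have hlow : Real.exp (-(c * (cT * T) ^ 4 * Real.log (cT * T) ^ 24)) / (‖δ‖ ^ (n * D) * MA ^ Ec) ≤
      ‖aeval ξ A‖ := by
    rw [div_le_iff₀ hden]
    calc Real.exp (-(c * (cT * T) ^ 4 * Real.log (cT * T) ^ 24)) ≤ ‖δ‖ ^ (n * D) * (‖aeval ξ A‖ * MA ^ Ec) :=
          hchain
      _ = ‖aeval ξ A‖ * (‖δ‖ ^ (n * D) * MA ^ Ec) := by ring
  refine le_trans ?_ hlow
  have hden' : ‖δ‖ ^ (n * D) * MA ^ Ec ≤ Real.exp (ν * T) := by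
    calc ‖δ‖ ^ (n * D) * MA ^ Ec
        ≤ Real.exp ((D : ℝ) * Real.log δ₁ * T) * Real.exp ((Ec : ℝ) * (4 + Real.log Rb) * T) :=
          mul_le_mul hδpow hMApow (pow_nonneg hMA0.le _) (Real.exp_pos _).le
      _ = Real.exp (ν * T) := by rw [← Real.exp_add, hν]; ring_nf
  have hνT : ν * T ≤ ν * T ^ 4 * Real.log T ^ 24 := by
    have h1 : T ≤ T ^ 4 := by
      calc T = T ^ 1 := (pow_one T).symm
        _ ≤ T ^ 4 := pow_le_pow_right₀ hT1 (by norm_num)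
    have h2 : T ^ 4 ≤ T ^ 4 * Real.log T ^ 24 := le_mul_of_one_le_right (by positivity) (one_le_pow₀ hlogT)
    calc ν * T ≤ ν * (T ^ 4 * Real.log T ^ 24) := mul_le_mul_of_nonneg_left (le_trans h1 h2) hν0
      _ = ν * T ^ 4 * Real.log T ^ 24 := by ring
  have hexp : (c * cT ^ 4 * κ + ν) * T ^ 4 * Real.log T ^ 24 =
      c * cT ^ 4 * κ * T ^ 4 * Real.log T ^ 24 + ν * T ^ 4 * Real.log T ^ 24 := by ring
  have hP : c * (cT * T) ^ 4 * Real.log (cT * T) ^ 24 + ν * T ≤ (c * cT ^ 4 * κ + ν) * T ^ 4 * Real.log T ^ 24 := by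
    rw [hexp]; exact add_le_add hmain hνT
  have hneg : -((c * cT ^ 4 * κ + ν) * T ^ 4 * Real.log T ^ 24) ≤
      -(c * (cT * T) ^ 4 * Real.log (cT * T) ^ 24) - ν * T := by
    rw [← neg_add']; exact neg_le_neg hP
  calc Real.exp (-((c * cT ^ 4 * κ + ν) * T ^ 4 * Real.log T ^ 24))
      ≤ Real.exp (-(c * (cT * T) ^ 4 * Real.log (cT * T) ^ 24)) / Real.exp (ν * T) := by
        rw [← Real.exp_sub, Real.exp_le_exp]; exact hneg
    _ ≤ Real.exp (-(c * (cT * T) ^ 4 * Real.log (cT * T) ^ 24)) / (‖δ‖ ^ (n * D) * MA ^ Ec) :=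
        div_le_div_of_nonneg_left (Real.exp_pos _).le hden hden'

/-! ## §5  Corollary 5.2 in full generality, hypothesis-free -/

/-- **LNM 1752 Ch. 3 Corollary 5.2 — PROVED in full generality** (every `q` with `0 < |q| < 1` and every
`ξ ∈ ℂ³` over which `q, P(q), Q(q), R(q)` are algebraic): the named Literature fact
`NesterenkoPhilippon2001_ch3_cor_5_2` holds outright. Proof = the book's (p. 47): the field bookkeeping (§1),
the measure (31) at the then-dependent point `ω = (q, P(q), Q(q), R(q))` from Theorem 5.1 / Prop. 4.11 / Prop. 4.8
with the principal prime `(p)` of a prime form vanishing at `ω̄` (§2–§3), and the norm step (§4).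
[cite: NesterenkoPhilippon2001, Ch. 3 Corollary 5.2 (pp. 46–47)] -/
theorem NesterenkoPhilippon2001_ch3_cor_5_2_holds : NesterenkoPhilippon2001_ch3_cor_5_2 := by
  intro q hq0 hq1 ξ halg
  obtain ⟨hdep, hξ, hLK⟩ := bookkeeping q hq0 hq1 ξ halg
  obtain ⟨c, hc, hmeas⟩ := measure31_of_dependent q hq0 hq1 hdep
  obtain ⟨μ, hμ, h⟩ := norm_step (ramanujanPoint q) ξ hξ hLK hc hmeas
  exact ⟨μ, hμ, fun A hA T hT => h A hA T hT⟩

/-- **Corollary 5.2, the `{π, e^π, Γ(1/4)}` clause — now binder-free**: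
`∃ μ > 0, ∀ A ∈ ℤ[x₁,x₂,x₃] ∖ 0, ∀ T ≥ max (H(A) + deg A) e, exp(−μ T⁴ log²⁴ T) ≤ |A(π, e^π, Γ(1/4))|`.
[cite: NesterenkoPhilippon2001, Ch. 3 Corollary 5.2 (p. 46)] -/
theorem NesterenkoPhilippon2001_ch3_cor_5_2_pi :
    ∃ μ : ℝ, 0 < μ ∧ ∀ A : MvPolynomial (Fin 3) ℤ, A ≠ 0 → ∀ T : ℝ,
      max (((A.support.sup fun m => (A.coeff m).natAbs : ℕ) : ℝ) + (A.totalDegree : ℝ))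
          (Real.exp 1) ≤ T →
        Real.exp (-(μ * T ^ 4 * Real.log T ^ 24)) ≤
          ‖MvPolynomial.aeval ![(Real.pi : ℂ), cexp (Real.pi : ℂ), (Real.Gamma (1 / 4) : ℂ)] A‖ :=
  NesterenkoPhilippon2001_ch3_cor_5_2_pi_of NesterenkoPhilippon2001_ch3_cor_5_2_holds

end Summit.Schanuel.Schanuel.Theorems.RootDecomp1KCor52

end
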